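import Literature.AlgebraicGeometry.AbelianSchemes.RelFrobeniusVersusEndomorphism
import Literature.AlgebraicGeometry.AbelianSchemes.SerreTensorRecognition
import HarnessLib

/-!
# (σ2-CORE) Frobenius = Hecke quasi-isogeny × `π₀`, in Serre-tensor currency: `A^{(q)} ≅ B` with `ψ_𝔭 ∘ E ∘ F_{A/k,q} = ι(π₀) ∘ ρ′`

Topic `Literature/AlgebraicGeometry/AbelianSchemes`, namespace `Literature.AlgebraicGeometry.AbelianSchemes.AbelianSchemeOver` (THEOREMS ONLY; no
definition, no named fact, no `sorry`, no `instance`, no notation).  Cell `hodgecm-mathlib`, F0/P6 «MOD», the σ2 = (β′) SPINE organ of `stub_HFROB`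
(LEAD M-16b (3): «block computation via SERRE-TENSOR recognition of `A^{(q)}`»; desk F0P6a-plan SPEC v1.2 (ii-4) and `Cruxes/HLiu418/HEART-FROB.md` v4.1
§0 e-6: `tuple(T_{t₁(w)}y) ≅ (A_y ∕ (H_L ⊕ K̃_L)) ⊗_{𝒪_F} 𝔭_w`, the Frobenius quotient `A ∕ Ker F_q` is the companion `⊗ 𝔠⁻¹`, «brought back by
`(π₀) = 𝔭_w^{d_w}·𝔟`»), over ABSTRACT binders (no `ModuliDatum`); sequel to ★ FROB₀-organ `RelFrobeniusVersusEndomorphism`, ★ ST-2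
`SerreTensorRecognition`, ★ KER-EQ `AbelianSchemeHomDescentKernelEq`, ★ (A) `SerreTensorIdealTranslationKernel`; `--supports stmt-HodgeConjecture-24832`,
count-neutral.  HC_CM is proved only modulo the 2 remaining named inputs (hLiu418, h413) until rung 0 closes; this file discharges none of them.

## Mathematics

`k` a field of exponential characteristic `p`, `q = pⁿ`, `(A, ι)` and `(B, ι_B)` abelian varieties over `k` with `𝒪`-actions (★ `RingAction` on the abelian
`k`-schemes `A₀ = (ofAbelianVariety A).toOver`, `B₀`), `F = F_{A/k,q} : A → A^{(q)}` the relative Frobenius (★ `relFrobeniusHom`, `𝒪`-equivariant for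
`ι^{(q)}`, ★ ST-2F §1).  For a presented module `𝔟 = E·𝒪ᵐ` and a column `P ∈ 𝔟` whose coordinates generate the ideal `𝔠`, with a quasi-inverse row `Q` up to
`N ≠ 0`, ★ (A) gives the ideal translation `ψ_𝔠 : X → X ⊗_𝒪 𝔟` («`X → X ⊗ 𝔠⁻¹`»): an `𝒪`-equivariant finite flat surjective homomorphism with kernel `X[𝔠]`.

§1 KERNEL BOOKKEEPING (any base `S`).  For an `𝒪`-equivariant `φ : A → B`: `Ker(φ ≫ ψ_𝔠) = {t : ∀ c ∈ 𝔠, ι(c) t ∈ Ker φ}`; and for two translations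
`ψ_𝔭 : A → A ⊗ 𝔭⁻¹`, `ψ_𝔠 : A ⊗ 𝔭⁻¹ → (A ⊗ 𝔭⁻¹) ⊗ 𝔠⁻¹`: **`Ker(ψ_𝔭 ≫ ψ_𝔠) = A[𝔭𝔠]`** on `T`-points (the annihilator of a point is an ideal, ★
`comp_i_eq_one_of_mem_span`; products `ac` generate `𝔭𝔠`).

§2 (σ2-CORE-1) **RECOGNITION THROUGH THE HECKE QUOTIENT.**  Let `φ : A → B′` be an `𝒪`-equivariant fppf homomorphism to ANY `𝒪`-abelian `k`-scheme `B′`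
(model: `B′ = B ⊗ 𝔭_w⁻¹ ≅ A ∕ (C₀ ⊕ K̄)`, the Hecke quotient in recognition form) and suppose the BLOCK COMPUTATION `Ker F = φ⁻¹(B′[𝔠])` on `T`-points
(`t ≫ F = 1 ↔ ∀ c ∈ 𝔠, ι(c) t ≫ φ = 1`; model: `Ker F_q = C₀ ⊕ [ϖ̄^{d_w−1}]⁻¹(C₀^⊥) ⊕ banal[π₀]`, `𝔠 = 𝔭_w^{d_w−1}·𝔟`).  Then there is a UNIQUE
`e : A^{(q)} ≅ B′ ⊗ 𝔠⁻¹` under `A` with `F ≫ e = φ ≫ ψ_𝔠`; it is a homomorphism and `𝒪`-equivariant (★ KER-EQ through ★ FROB₀-organ §1 with `φ ≫ ψ_𝔠`;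
RANK-FREE: no `d_w`, no `q`-count).

§3 (σ2-CORE-2) **«BROUGHT BACK BY `(π₀) = 𝔭𝔠`».**  If `π₀ π₁ = N ≠ 0` in `𝒪` (so `ι_B(π₀)` is fppf, ★ FROB₀-organ §2) and `𝔭·𝔠 = (π₀)`, then §1 gives
`Ker(ψ_𝔭 ≫ ψ_𝔠) = B[(π₀)] = Ker ι_B(π₀)`, so ★ KER-EQ yields a UNIQUE `e′ : (B ⊗ 𝔭⁻¹) ⊗ 𝔠⁻¹ ≅ B` with `ψ_𝔭 ≫ ψ_𝔠 ≫ e′ = ι_B(π₀)`, a homomorphism,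
`𝒪`-equivariant; consequently `ψ_𝔠 ≫ e′ ≫ ψ_𝔭 = ι_{B⊗𝔭⁻¹}(π₀)` (cancel the fppf epimorphism `ψ_𝔭`).

§4 (σ2-CORE) **ASSEMBLY.**  With `ρ′ : A → B ⊗ 𝔭⁻¹` `𝒪`-equivariant fppf (the Hecke datum, D4 (b) downstairs), `Ker F = ρ′⁻¹((B ⊗ 𝔭⁻¹)[𝔠])`,
`π₀ π₁ = N ≠ 0`, `𝔭𝔠 = (π₀)`: `E := e ≪≫ e′ : A^{(q)} ≅ B` is an `𝒪`-equivariant isomorphism of abelian `k`-schemes with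
  **`F ≫ E ≫ ψ_𝔭 = ρ′ ≫ ι_{B⊗𝔭⁻¹}(π₀)`**,
the cleared-denominator form of `E ∘ F_{A/k,q} = ψ̄ ∘ ι(π₀)` for the Hecke QUASI-isogeny `ψ̄ = ψ_𝔭⁻¹ ∘ ρ′ : A ⇢ B`.  This is the relation that matches the
level structures (`η^{(q)}`, through ★ FROB₀ `e₀ : A₀^{(q)} ≅ A₀`, `F₀ ↦ ι₀(π₀)`: `E f^{(q)} e₀⁻¹ = ψ̄ f` on prime-to-`p` points since `f ι₀(π₀) = ι(π₀) f`) and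
the polarizations (`F^*λ^{(q)} = qλ = ι(π₀)^*λ` by Rosati, `π₀π̄₀ = q`; λ-clause in a sequel over ★ `AbelianSchemeHomDescentPolarized`) in HFROB′ ∕ (c3a):
«quotient by the canonical subgroup (+ annihilator position), tensored back by `𝔭_w`, IS the Frobenius twist» ([RapoportSmithlingZhang2020Diagonal] (4.23),
[Liu2021] Prop. D.8 (3), [Shimura1998] §13.1 Thm. 1).  INPUTS LEFT TO THE CONSUMER: the block computation (`hker`; P6b «BlockNumerics» N0–N3 + `ModuliDatum`
D2∕D3 + FROB₀∕BANAL), the Hecke datum `ρ′` downstairs (D4 (b) + (c2)), INJ.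

## Contents

* §1 `comp_comp_serreTranslate_eq_one_iff_forall_mem` (`Ker(φ ≫ ψ_𝔠)`), `comp_serreTranslate_comp_serreTranslate_eq_one_iff_forall_mem` (`Ker(ψ_𝔭ψ_𝔠) = A[𝔭𝔠]`),
  `comp_serreTranslate_comp_serreTranslate_eq_one_iff_of_mul_eq_span` (`= Ker ι(π₀)` when `𝔭𝔠 = (π₀)`).
* §2 **`exists_iso_relFrobeniusHom_comp_eq_comp_serreTranslate`** (σ2-CORE-1).
* §3 **`exists_iso_serreTranslate_comp_serreTranslate_comp_eq_i`** (σ2-CORE-2), `serreTranslate_comp_comp_serreTranslate_eq_i_of` (`ψ_𝔠 ≫ e′ ≫ ψ_𝔭 = ι_{B⊗𝔭⁻¹}(π₀)`).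
* §4 **`exists_iso_relFrobeniusHom_comp_comp_serreTranslate_eq`** (σ2-CORE: `A^{(q)} ≅ B`, `F ≫ E ≫ ψ_𝔭 = ρ′ ≫ ι(π₀)`).

## References
* [Shimura1998] G. Shimura, *Abelian Varieties with Complex Multiplication and Modular Functions* (1998), §13.1 Thm. 1 (pp. 97–99) (`N(λ̃) = q` ⇒ the Frobenius factor
  is an isomorphism; the `𝔞`-multiplication shape of Frobenius).
* [MilneCM2006] J. S. Milne, *Complex Multiplication* (2006), §7 (Def. 7.19, Prop. 7.22, Rem. 7.23: `A → A ⊗ 𝔞⁻¹ = A⁄A[𝔞]`), §8 (Thm. 8.1).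
* [MumfordAV1970] D. Mumford, *Abelian Varieties* (1970), §7 Thm. 4 (p. 72), §15 (p. 146).
* [RapoportSmithlingZhang2020Diagonal] M. Rapoport, B. Smithling, W. Zhang (2020), §4.3 (p. 20), (4.23) (p. 21: `A′ = A∕C`, `p^{2δ}λ = φ^∨λ′φ`).
* [Liu2021] Y. Liu (2021), Prop. D.8 (3) (p. 135), pp. 137–138 (Frobenius = the `t₁(w)`-Hecke translate on the special fibre).
* [Conrad2004GrossZagier] B. Conrad, *Gross–Zagier revisited* (2004), §7 Thm. 7.5 (Serre tensor, ideal translations).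
* Tree: ★ `RelFrobeniusVersusEndomorphism` (FROB₀-organ §1–§2), ★ `AbelianSchemeHomDescentKernelEq` (KER-EQ), ★ `SerreTensorRecognition` (ST-2),
  ★ `SerreTensorIdealTranslationKernel` (A), ★ `SerreTensorFrobeniusTwist` (ST-2F §0–§1), ★ `AbelianSchemeHomDescentEquivariant` (`cancel_left_of_flat_surjective`).
-/

noncomputable section

universe u

open CategoryTheory CategoryTheory.Limits AlgebraicGeometry MonoidalCategory CartesianMonoidalCategory
open scoped MonObj

namespace Literature.AlgebraicGeometry.AbelianSchemes

namespace AbelianSchemeOver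

/-! ## §1 Kernel bookkeeping for composites with an ideal translation (any base) -/

section Kernel

variable {S : Scheme.{u}} {A B : AbelianSchemeOver S} {O : Type*} [CommRing O] (actA : A.RingAction O) (actB : B.RingAction O)
  [IsCommMonObj A.X] [IsCommMonObj B.X] (φ : A.X ⟶ B.X)
  {m : ℕ} (E : Matrix (Fin m) (Fin m) O) (hE : E * E = E) (P : Matrix (Fin m) (Fin 1) O)
  {m₁ : ℕ} (E₁ : Matrix (Fin m₁) (Fin m₁) O) (hE₁ : E₁ * E₁ = E₁) (P₁ : Matrix (Fin m₁) (Fin 1) O)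
  {m₂ : ℕ} (E₂ : Matrix (Fin m₂) (Fin m₂) O) (hE₂ : E₂ * E₂ = E₂) (P₂ : Matrix (Fin m₂) (Fin 1) O)
  [IsCommMonObj (serreTensor actA E₁ hE₁).X]

omit [IsCommMonObj A.X] [IsCommMonObj (serreTensor actA E₁ hE₁).X] in
/-- **`Ker(φ ≫ ψ_𝔠) = {t : ι(𝔠) t ⊆ Ker φ}`**: for an `𝒪`-equivariant `φ : A → B` and the ideal translation `ψ_𝔠 : B → B ⊗_𝒪 𝔟` of ★ (A) (coordinates of `P`
generating `𝔠`), a `T`-point `t` of `A` dies under `φ ≫ ψ_𝔠` iff `ι(c) t ≫ φ = 1` for all `c ∈ 𝔠` (★ `comp_serreTranslate_eq_one_iff_forall_mem` at the point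
`t ≫ φ`, then equivariance). [cite: Conrad2004GrossZagier, §7 (Thm. 7.5)] [cite: MilneCM2006, §7 (Def. 7.19, Prop. 7.22, Rem. 7.23)] -/
theorem comp_comp_serreTranslate_eq_one_iff_forall_mem (hφ : ∀ a, actA.i a ≫ φ = φ ≫ actB.i a) (hP : E * P = P) {𝔠 : Ideal O}
    (h𝔠 : Ideal.span (Set.range fun k => P k 0) = 𝔠) {T : Over S} (t : T ⟶ A.X) :
    t ≫ φ ≫ serreTranslate actB E hE P = 1 ↔ ∀ c ∈ 𝔠, t ≫ actA.i c ≫ φ = 1 := by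
  rw [← Category.assoc, comp_serreTranslate_eq_one_iff_forall_mem actB E hE P hP h𝔠]
  refine forall₂_congr fun c _ => ?_
  rw [Category.assoc, ← hφ c]

omit [IsCommMonObj B.X] in
/-- **`Ker(ψ_𝔭 ≫ ψ_𝔠) = A[𝔭𝔠]` on points**: for the ideal translations `ψ_𝔭 : A → A ⊗ 𝔭⁻¹` (coordinates of `P₁` generating `𝔭`) and
`ψ_𝔠 : A ⊗ 𝔭⁻¹ → (A ⊗ 𝔭⁻¹) ⊗ 𝔠⁻¹` (coordinates of `P₂` generating `𝔠`, for the Serre action on `A ⊗ 𝔭⁻¹`), a `T`-point `t` of `A` dies under the composite iff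
`ι(x) t = 1` for all `x ∈ 𝔭·𝔠` (the annihilator of `t` is an ideal, ★ `comp_i_eq_one_of_mem_span`; `𝔭𝔠` is generated by the products `a·c`) — the torsion of a
product of ideals is reached by composing the translations, `A ⊗ (𝔭𝔠)⁻¹ = (A ⊗ 𝔭⁻¹) ⊗ 𝔠⁻¹`. [cite: MilneCM2006, §7 (Def. 7.19, Prop. 7.22, Rem. 7.23)]
[cite: Conrad2004GrossZagier, §7 (Thm. 7.5)] -/
theorem comp_serreTranslate_comp_serreTranslate_eq_one_iff_forall_mem (hP₁ : E₁ * P₁ = P₁) (hP₂ : E₂ * P₂ = P₂) {𝔭 𝔠 : Ideal O}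
    (h𝔭 : Ideal.span (Set.range fun k => P₁ k 0) = 𝔭) (h𝔠 : Ideal.span (Set.range fun k => P₂ k 0) = 𝔠) {T : Over S} (t : T ⟶ A.X) :
    t ≫ serreTranslate actA E₁ hE₁ P₁ ≫ serreTranslate (serreAction actA E₁ hE₁) E₂ hE₂ P₂ = 1 ↔ ∀ x ∈ 𝔭 * 𝔠, t ≫ actA.i x = 1 := by
  rw [comp_comp_serreTranslate_eq_one_iff_forall_mem actA (serreAction actA E₁ hE₁) (serreTranslate actA E₁ hE₁ P₁) E₂ hE₂ P₂
    (i_comp_serreTranslate actA E₁ hE₁ P₁ hP₁) hP₂ h𝔠]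
  constructor
  · intro h x hx
    refine Submodule.mul_induction_on hx (fun a ha c hc => ?_) (fun x y hx hy => ?_)
    · have hc' : (t ≫ actA.i c) ≫ serreTranslate actA E₁ hE₁ P₁ = 1 := by rw [Category.assoc]; exact h c hc
      rw [actA.comp_i_mul]
      exact (comp_serreTranslate_eq_one_iff_forall_mem actA E₁ hE₁ P₁ hP₁ h𝔭 (t ≫ actA.i c)).mp hc' a ha
    · rw [actA.comp_i_add, hx, hy, mul_one]
  · intro h c hc
    rw [← Category.assoc, comp_serreTranslate_eq_one_iff_forall_mem actA E₁ hE₁ P₁ hP₁ h𝔭]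
    intro a ha
    rw [← actA.comp_i_mul]
    exact h _ (Ideal.mul_mem_mul ha hc)

omit [IsCommMonObj B.X] in
/-- **`Ker(ψ_𝔭 ≫ ψ_𝔠) = Ker ι(π₀)` when `𝔭·𝔠 = (π₀)`** (§1 with the principal ideal `(π₀)`: `A[(π₀)] = Ker ι(π₀)`).
[cite: MilneCM2006, §7 (Def. 7.19, Prop. 7.22, Rem. 7.23)] [cite: Shimura1998, §13.1 Thm. 1 (pp. 97–99)] -/
theorem comp_serreTranslate_comp_serreTranslate_eq_one_iff_of_mul_eq_span (hP₁ : E₁ * P₁ = P₁) (hP₂ : E₂ * P₂ = P₂) {𝔭 𝔠 : Ideal O}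
    (h𝔭 : Ideal.span (Set.range fun k => P₁ k 0) = 𝔭) (h𝔠 : Ideal.span (Set.range fun k => P₂ k 0) = 𝔠) {π₀ : O} (h𝔭𝔠 : 𝔭 * 𝔠 = Ideal.span {π₀})
    {T : Over S} (t : T ⟶ A.X) :
    t ≫ serreTranslate actA E₁ hE₁ P₁ ≫ serreTranslate (serreAction actA E₁ hE₁) E₂ hE₂ P₂ = 1 ↔ t ≫ actA.i π₀ = 1 := by
  rw [comp_serreTranslate_comp_serreTranslate_eq_one_iff_forall_mem actA E₁ hE₁ P₁ E₂ hE₂ P₂ hP₁ hP₂ h𝔭 h𝔠, h𝔭𝔠]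
  refine ⟨fun h => h π₀ (Ideal.mem_span_singleton_self π₀), fun h x hx => ?_⟩
  exact comp_i_eq_one_of_mem_span actA t (s := {π₀}) (fun a ha => by rw [Set.mem_singleton_iff.mp ha]; exact h) hx

end Kernel

/-! ## §2 (σ2-CORE-1) Recognition of the Frobenius twist through the Hecke quotient: `A^{(q)} ≅ B′ ⊗ 𝔠⁻¹`, `F ↦ φ ≫ ψ_𝔠` -/

section Recognition

open Literature.AlgebraicGeometry.Motives Literature.AlgebraicGeometry.Motives.AbelianVariety

variable {k : Type u} [Field k] (p : ℕ) [ExpChar k p] (n : ℕ) {A : AbelianVariety k} {O : Type*} [CommRing O]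
  (act : (AbelianScheme.ofAbelianVariety A).toOver.RingAction O) [IsMonHom (relFrobeniusHom p n A)]
  {B' : AbelianSchemeOver (Spec (.of k))} (actB' : B'.RingAction O) [IsCommMonObj B'.X]
  (φ : (AbelianScheme.ofAbelianVariety A).toOver.X ⟶ B'.X) [IsMonHom φ] [Flat φ.left] [Surjective φ.left] [QuasiCompact φ.left]
  {m : ℕ} (E : Matrix (Fin m) (Fin m) O) (hE : E * E = E) (P : Matrix (Fin m) (Fin 1) O) (Q : Matrix (Fin 1) (Fin m) O) {N : ℕ}

/-- **(σ2-CORE-1) `Ker F_{A/k,q} = φ⁻¹(B′[𝔠])` ⇒ `A^{(q)} ≅ B′ ⊗_𝒪 𝔠⁻¹` under `A`, `F ↦ φ ≫ ψ_𝔠`, `𝒪`-equivariantly, uniquely.**  Here `φ : A → B′` is any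
`𝒪`-equivariant homomorphism to an `𝒪`-abelian `k`-scheme whose underlying map is flat, surjective and quasi-compact (model: the Hecke quotient `A → B ⊗ 𝔭_w⁻¹ ≅
A ∕ (C₀ ⊕ K̄)` in recognition form), `ψ_𝔠 : B′ → B′ ⊗ 𝔟` the ideal translation of ★ (A) for a column `P` (coordinates generating `𝔠`) with quasi-inverse row `Q` up to
`N ≠ 0`, and the hypothesis is the BLOCK COMPUTATION of `Ker F` on `T`-points (model: `Ker F_q = C₀ ⊕ [ϖ̄^{d_w−1}]⁻¹(C₀^⊥) ⊕ banal[π₀]`, `𝔠 = 𝔭_w^{d_w−1}𝔟`).  RANK-FREE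
(★ KER-EQ via ★ FROB₀-organ §1 with the fppf composite `φ ≫ ψ_𝔠`, §1 for its kernel). [cite: Shimura1998, §13.1 Thm. 1 (pp. 97–99)]
[cite: MumfordAV1970, §7 Thm. 4 (p. 72)] [cite: RapoportSmithlingZhang2020Diagonal, §4.3 (p. 20), (4.23) (p. 21)] -/
theorem exists_iso_relFrobeniusHom_comp_eq_comp_serreTranslate (hφ : ∀ a, act.i a ≫ φ = φ ≫ actB'.i a) (hN : N ≠ 0) (hP : E * P = P)
    (hQ : Q * E = Q) (hQP : Q * P = Matrix.scalar (Fin 1) (N : O)) (hPQ : P * Q = Matrix.scalar (Fin m) (N : O) * E) {𝔠 : Ideal O}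
    (h𝔠 : Ideal.span (Set.range fun k => P k 0) = 𝔠)
    (hker : ∀ ⦃T : Over (Spec (.of k))⦄ (t : T ⟶ (AbelianScheme.ofAbelianVariety A).toOver.X),
      t ≫ relFrobeniusHom p n A = 1 ↔ ∀ c ∈ 𝔠, t ≫ act.i c ≫ φ = 1) :
    ∃ e : (AbelianScheme.ofAbelianVariety (A.frobeniusTwist p n)).toOver.X ≅ (serreTensor actB' E hE).X,
      relFrobeniusHom p n A ≫ e.hom = φ ≫ serreTranslate actB' E hE P ∧ IsMonHom e.hom ∧
        (∀ a, (act.frobeniusTwist p n).i a ≫ e.hom = e.hom ≫ (serreAction actB' E hE).i a) ∧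
          ∀ χ : (AbelianScheme.ofAbelianVariety (A.frobeniusTwist p n)).toOver.X ⟶ (serreTensor actB' E hE).X,
            relFrobeniusHom p n A ≫ χ = φ ≫ serreTranslate actB' E hE P → χ = e.hom := by
  haveI := isMonHom_serreTranslate actB' E hE P
  haveI := isFinite_serreTranslate_left actB' E hE P Q hN hP hQ hQP hPQ
  haveI := flat_serreTranslate_left actB' E hE P Q hN hP hQ hQP hPQ
  haveI := surjective_serreTranslate_left actB' E hE P Q hN hP hQ hQP hPQ
  haveI : Flat (φ ≫ serreTranslate actB' E hE P).left := by rw [Over.comp_left]; infer_instance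
  haveI : Surjective (φ ≫ serreTranslate actB' E hE P).left := by rw [Over.comp_left]; infer_instance
  haveI : QuasiCompact (φ ≫ serreTranslate actB' E hE P).left := by rw [Over.comp_left]; infer_instance
  refine exists_iso_relFrobeniusHom_comp_eq_of_comp_eq_one_iff p n act (serreAction actB' E hE) (φ ≫ serreTranslate actB' E hE P)
    (fun a => ?_) fun T t => ?_
  · rw [← Category.assoc, hφ a, Category.assoc, i_comp_serreTranslate actB' E hE P hP a, Category.assoc]
  · rw [hker t, comp_comp_serreTranslate_eq_one_iff_forall_mem act actB' φ E hE P hφ hP h𝔠 t]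

end Recognition

/-! ## §3 (σ2-CORE-2) «Brought back by `(π₀) = 𝔭𝔠`»: `(B ⊗ 𝔭⁻¹) ⊗ 𝔠⁻¹ ≅ B` along `ι_B(π₀)` -/

section Principal

open Literature.AlgebraicGeometry.Motives Literature.AlgebraicGeometry.Motives.AbelianVariety

variable {k : Type u} [Field k] {B : AbelianVariety k} {O : Type*} [CommRing O]
  (actB : (AbelianScheme.ofAbelianVariety B).toOver.RingAction O) [IsCommMonObj (AbelianScheme.ofAbelianVariety B).toOver.X]
  {m₁ : ℕ} (E₁ : Matrix (Fin m₁) (Fin m₁) O) (hE₁ : E₁ * E₁ = E₁) (P₁ : Matrix (Fin m₁) (Fin 1) O) (Q₁ : Matrix (Fin 1) (Fin m₁) O) {N₁ : ℕ}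
  {m₂ : ℕ} (E₂ : Matrix (Fin m₂) (Fin m₂) O) (hE₂ : E₂ * E₂ = E₂) (P₂ : Matrix (Fin m₂) (Fin 1) O) (Q₂ : Matrix (Fin 1) (Fin m₂) O) {N₂ : ℕ}
  [IsCommMonObj (serreTensor actB E₁ hE₁).X]

/-- **(σ2-CORE-2) `(B ⊗ 𝔭⁻¹) ⊗ 𝔠⁻¹ ≅ B` with `ψ_𝔭 ≫ ψ_𝔠 ≫ e′ = ι_B(π₀)`, when `𝔭𝔠 = (π₀)` and `π₀ π₁ = N ≠ 0`.**  Both `ψ_𝔭 ≫ ψ_𝔠` (★ (A): presentations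
with quasi-inverse rows) and `ι_B(π₀)` (★ FROB₀-organ §2: quasi-inverse `ι_B(π₁)`) are `𝒪`-equivariant homomorphisms out of `B` with flat surjective quasi-compact
underlying maps and the SAME kernel `B[(π₀)]` on points (§1), so ★ KER-EQ identifies their targets under `B`, uniquely, by a homomorphism, `𝒪`-equivariantly —
«the Serre tensor by a principal ideal is trivialised by its generator». [cite: MilneCM2006, §7 (Def. 7.19, Prop. 7.22, Rem. 7.23)]
[cite: MumfordAV1970, §7 Thm. 4 (p. 72)] [cite: Shimura1998, §13.1 Thm. 1 (pp. 97–99)] -/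
theorem exists_iso_serreTranslate_comp_serreTranslate_comp_eq_i (hN₁ : N₁ ≠ 0) (hP₁ : E₁ * P₁ = P₁) (hQ₁ : Q₁ * E₁ = Q₁)
    (hQP₁ : Q₁ * P₁ = Matrix.scalar (Fin 1) (N₁ : O)) (hPQ₁ : P₁ * Q₁ = Matrix.scalar (Fin m₁) (N₁ : O) * E₁)
    (hN₂ : N₂ ≠ 0) (hP₂ : E₂ * P₂ = P₂) (hQ₂ : Q₂ * E₂ = Q₂)
    (hQP₂ : Q₂ * P₂ = Matrix.scalar (Fin 1) (N₂ : O)) (hPQ₂ : P₂ * Q₂ = Matrix.scalar (Fin m₂) (N₂ : O) * E₂)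
    {𝔭 𝔠 : Ideal O} (h𝔭 : Ideal.span (Set.range fun k => P₁ k 0) = 𝔭) (h𝔠 : Ideal.span (Set.range fun k => P₂ k 0) = 𝔠)
    {π₀ π₁ : O} {N : ℕ} (hN : N ≠ 0) (hπ : π₀ * π₁ = (N : O)) (h𝔭𝔠 : 𝔭 * 𝔠 = Ideal.span {π₀}) :
    ∃ e' : (serreTensor (serreAction actB E₁ hE₁) E₂ hE₂).X ≅ (AbelianScheme.ofAbelianVariety B).toOver.X,
      serreTranslate actB E₁ hE₁ P₁ ≫ serreTranslate (serreAction actB E₁ hE₁) E₂ hE₂ P₂ ≫ e'.hom = actB.i π₀ ∧ IsMonHom e'.hom ∧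
        (∀ a, (serreAction (serreAction actB E₁ hE₁) E₂ hE₂).i a ≫ e'.hom = e'.hom ≫ actB.i a) ∧
          ∀ χ : (serreTensor (serreAction actB E₁ hE₁) E₂ hE₂).X ⟶ (AbelianScheme.ofAbelianVariety B).toOver.X,
            serreTranslate actB E₁ hE₁ P₁ ≫ serreTranslate (serreAction actB E₁ hE₁) E₂ hE₂ P₂ ≫ χ = actB.i π₀ → χ = e'.hom := by
  -- fppf and homomorphism properties of the two translations and of `ι_B(π₀)`
  haveI := isMonHom_serreTranslate actB E₁ hE₁ P₁
  haveI := isFinite_serreTranslate_left actB E₁ hE₁ P₁ Q₁ hN₁ hP₁ hQ₁ hQP₁ hPQ₁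
  haveI := flat_serreTranslate_left actB E₁ hE₁ P₁ Q₁ hN₁ hP₁ hQ₁ hQP₁ hPQ₁
  haveI := surjective_serreTranslate_left actB E₁ hE₁ P₁ Q₁ hN₁ hP₁ hQ₁ hQP₁ hPQ₁
  haveI := isMonHom_serreTranslate (serreAction actB E₁ hE₁) E₂ hE₂ P₂
  haveI := isFinite_serreTranslate_left (serreAction actB E₁ hE₁) E₂ hE₂ P₂ Q₂ hN₂ hP₂ hQ₂ hQP₂ hPQ₂
  haveI := flat_serreTranslate_left (serreAction actB E₁ hE₁) E₂ hE₂ P₂ Q₂ hN₂ hP₂ hQ₂ hQP₂ hPQ₂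
  haveI := surjective_serreTranslate_left (serreAction actB E₁ hE₁) E₂ hE₂ P₂ Q₂ hN₂ hP₂ hQ₂ hQP₂ hPQ₂
  haveI : Flat (serreTranslate actB E₁ hE₁ P₁ ≫ serreTranslate (serreAction actB E₁ hE₁) E₂ hE₂ P₂).left := by
    rw [Over.comp_left]; infer_instance
  haveI : Surjective (serreTranslate actB E₁ hE₁ P₁ ≫ serreTranslate (serreAction actB E₁ hE₁) E₂ hE₂ P₂).left := by
    rw [Over.comp_left]; infer_instance
  haveI : QuasiCompact (serreTranslate actB E₁ hE₁ P₁ ≫ serreTranslate (serreAction actB E₁ hE₁) E₂ hE₂ P₂).left := by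
    rw [Over.comp_left]; infer_instance
  haveI := actB.isMonHom π₀
  haveI := actB.isFinite_i_left_of_mul_eq hN hπ
  haveI := actB.flat_i_left_of_mul_eq hN hπ
  haveI := actB.surjective_i_left_of_mul_eq hN hπ
  -- equivariance of the composite translation and its kernel `B[(π₀)] = Ker ι_B(π₀)` (§1)
  have hψ : ∀ a, actB.i a ≫ serreTranslate actB E₁ hE₁ P₁ ≫ serreTranslate (serreAction actB E₁ hE₁) E₂ hE₂ P₂ =
      (serreTranslate actB E₁ hE₁ P₁ ≫ serreTranslate (serreAction actB E₁ hE₁) E₂ hE₂ P₂) ≫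
        (serreAction (serreAction actB E₁ hE₁) E₂ hE₂).i a := fun a => by
    simp only [← Category.assoc, i_comp_serreTranslate actB E₁ hE₁ P₁ hP₁ a]
    simp only [Category.assoc, i_comp_serreTranslate (serreAction actB E₁ hE₁) E₂ hE₂ P₂ hP₂ a]
  have hker : ∀ ⦃T : Over (Spec (.of k))⦄ (t : T ⟶ (AbelianScheme.ofAbelianVariety B).toOver.X),
      t ≫ serreTranslate actB E₁ hE₁ P₁ ≫ serreTranslate (serreAction actB E₁ hE₁) E₂ hE₂ P₂ = 1 ↔ t ≫ actB.i π₀ = 1 := fun T t =>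
    comp_serreTranslate_comp_serreTranslate_eq_one_iff_of_mul_eq_span actB E₁ hE₁ P₁ E₂ hE₂ P₂ hP₁ hP₂ h𝔭 h𝔠 h𝔭𝔠 t
  obtain ⟨e', he', hmon, heq, huniq⟩ := exists_iso_comp_eq_equivariant_of_comp_eq_one_iff
    (serreTranslate actB E₁ hE₁ P₁ ≫ serreTranslate (serreAction actB E₁ hE₁) E₂ hE₂ P₂) (actB.i π₀) actB actB
    (serreAction (serreAction actB E₁ hE₁) E₂ hE₂) hψ (fun a => actB.i_comm a π₀) hker
  exact ⟨e', by rw [← Category.assoc]; exact he', hmon, heq, fun χ hχ => huniq χ (by rw [Category.assoc]; exact hχ)⟩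

omit [IsCommMonObj (serreTensor actB E₁ hE₁).X] in
/-- **`ψ_𝔠 ≫ e′ ≫ ψ_𝔭 = ι_{B⊗𝔭⁻¹}(π₀)`**: the rescaling `e′` of §3 read on `B ⊗ 𝔭⁻¹` — from `ψ_𝔭 ≫ ψ_𝔠 ≫ e′ = ι_B(π₀)`, the equivariance `ι_B(π₀) ≫ ψ_𝔭 =
ψ_𝔭 ≫ ι_{B⊗𝔭⁻¹}(π₀)` and cancellation of the fppf epimorphism `ψ_𝔭` (★ `cancel_left_of_flat_surjective`). [cite: MumfordAV1970, §7 Thm. 4 (p. 72)]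
[cite: MilneCM2006, §7 (Def. 7.19, Prop. 7.22, Rem. 7.23)] -/
theorem serreTranslate_comp_comp_serreTranslate_eq_i_of [IsCommMonObj (serreTensor actB E₁ hE₁).X] (hN₁ : N₁ ≠ 0) (hP₁ : E₁ * P₁ = P₁)
    (hQ₁ : Q₁ * E₁ = Q₁) (hQP₁ : Q₁ * P₁ = Matrix.scalar (Fin 1) (N₁ : O)) (hPQ₁ : P₁ * Q₁ = Matrix.scalar (Fin m₁) (N₁ : O) * E₁) {π₀ : O}
    (χ : (serreTensor (serreAction actB E₁ hE₁) E₂ hE₂).X ⟶ (AbelianScheme.ofAbelianVariety B).toOver.X)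
    (hχ : serreTranslate actB E₁ hE₁ P₁ ≫ serreTranslate (serreAction actB E₁ hE₁) E₂ hE₂ P₂ ≫ χ = actB.i π₀) :
    serreTranslate (serreAction actB E₁ hE₁) E₂ hE₂ P₂ ≫ χ ≫ serreTranslate actB E₁ hE₁ P₁ =
      (serreAction actB E₁ hE₁).i π₀ := by
  haveI := isMonHom_serreTranslate actB E₁ hE₁ P₁
  haveI := isFinite_serreTranslate_left actB E₁ hE₁ P₁ Q₁ hN₁ hP₁ hQ₁ hQP₁ hPQ₁
  haveI := flat_serreTranslate_left actB E₁ hE₁ P₁ Q₁ hN₁ hP₁ hQ₁ hQP₁ hPQ₁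
  haveI := surjective_serreTranslate_left actB E₁ hE₁ P₁ Q₁ hN₁ hP₁ hQ₁ hQP₁ hPQ₁
  apply cancel_left_of_flat_surjective (AbelianScheme.ofAbelianVariety B).toOver (C := serreTensor actB E₁ hE₁)
    (serreTranslate actB E₁ hE₁ P₁)
  -- `ψ_𝔭 ≫ (ψ_𝔠 ≫ χ ≫ ψ_𝔭) = ι_B(π₀) ≫ ψ_𝔭 = ψ_𝔭 ≫ ι_{B⊗𝔭⁻¹}(π₀)`
  rw [← i_comp_serreTranslate actB E₁ hE₁ P₁ hP₁ π₀, ← hχ]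
  simp only [Category.assoc]

end Principal

/-! ## §4 (σ2-CORE) Assembly: `E : A^{(q)} ≅ B` with `F ≫ E ≫ ψ_𝔭 = ρ′ ≫ ι_{B⊗𝔭⁻¹}(π₀)` -/

section Assembly

open Literature.AlgebraicGeometry.Motives Literature.AlgebraicGeometry.Motives.AbelianVariety

variable {k : Type u} [Field k] (p : ℕ) [ExpChar k p] (n : ℕ) {A B : AbelianVariety k} {O : Type*} [CommRing O]
  (act : (AbelianScheme.ofAbelianVariety A).toOver.RingAction O) [IsMonHom (relFrobeniusHom p n A)]
  (actB : (AbelianScheme.ofAbelianVariety B).toOver.RingAction O) [IsCommMonObj (AbelianScheme.ofAbelianVariety B).toOver.X]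
  {m₁ : ℕ} (E₁ : Matrix (Fin m₁) (Fin m₁) O) (hE₁ : E₁ * E₁ = E₁) (P₁ : Matrix (Fin m₁) (Fin 1) O) (Q₁ : Matrix (Fin 1) (Fin m₁) O) {N₁ : ℕ}
  {m₂ : ℕ} (E₂ : Matrix (Fin m₂) (Fin m₂) O) (hE₂ : E₂ * E₂ = E₂) (P₂ : Matrix (Fin m₂) (Fin 1) O) (Q₂ : Matrix (Fin 1) (Fin m₂) O) {N₂ : ℕ}
  [IsCommMonObj (serreTensor actB E₁ hE₁).X]
  (ρ' : (AbelianScheme.ofAbelianVariety A).toOver.X ⟶ (serreTensor actB E₁ hE₁).X) [IsMonHom ρ'] [Flat ρ'.left] [Surjective ρ'.left]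
  [QuasiCompact ρ'.left]

include hE₂ in
/-- **(σ2-CORE) FROBENIUS = HECKE QUASI-ISOGENY × `π₀`.**  Data: `(A, ι)`, `(B, ι_B)` `𝒪`-abelian varieties over `k`, ideal translations `ψ_𝔭 : B → B ⊗ 𝔭⁻¹` and
`ψ_𝔠 : B ⊗ 𝔭⁻¹ → (B ⊗ 𝔭⁻¹) ⊗ 𝔠⁻¹` (★ (A); presentations `E₁, P₁, Q₁, N₁` ∕ `E₂, P₂, Q₂, N₂`, coordinates generating `𝔭` ∕ `𝔠`), an `𝒪`-equivariant fppf
homomorphism `ρ′ : A → B ⊗ 𝔭⁻¹` (the HECKE DATUM in recognition form — model `B ⊗ 𝔭_w⁻¹ ≅ A ∕ (C₀ ⊕ K̄)`, D4 (b) downstairs), `π₀ π₁ = N ≠ 0` and `𝔭𝔠 = (π₀)`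
(FROB₀ ∕ BANAL: `(π₀) = 𝔭_w^{d_w}·𝔟`, `𝔠 = 𝔭_w^{d_w−1}𝔟`), and the BLOCK COMPUTATION `Ker F_{A/k,q} = ρ′⁻¹((B ⊗ 𝔭⁻¹)[𝔠])` on `T`-points.  CONCLUSION: an
isomorphism `E : A^{(q)} ≅ B` of abelian `k`-schemes, a homomorphism, `𝒪`-equivariant (`ι^{(q)}(a) ≫ E = E ≫ ι_B(a)`), with
**`F ≫ E ≫ ψ_𝔭 = ρ′ ≫ ι_{B⊗𝔭⁻¹}(π₀)`** — i.e. `E ∘ F_{A/k,q} = ψ̄ ∘ ι(π₀)` for the Hecke quasi-isogeny `ψ̄ = ψ_𝔭⁻¹ ∘ ρ′ : A ⇢ B` («the `t₁(w)`-translate picked by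
the canonical line, tensored back by `𝔭_w`, is the Frobenius twist»; §2 `e : A^{(q)} ≅ (B ⊗ 𝔭⁻¹) ⊗ 𝔠⁻¹` composed with §3 `e′`).
[cite: RapoportSmithlingZhang2020Diagonal, §4.3 (p. 20), (4.23) (p. 21)] [cite: Liu2021, Prop. D.8 (3) (p. 135), pp. 137–138]
[cite: Shimura1998, §13.1 Thm. 1 (pp. 97–99)] [cite: MumfordAV1970, §7 Thm. 4 (p. 72)] -/
theorem exists_iso_relFrobeniusHom_comp_comp_serreTranslate_eq (hρ' : ∀ a, act.i a ≫ ρ' = ρ' ≫ (serreAction actB E₁ hE₁).i a)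
    (hN₁ : N₁ ≠ 0) (hP₁ : E₁ * P₁ = P₁) (hQ₁ : Q₁ * E₁ = Q₁)
    (hQP₁ : Q₁ * P₁ = Matrix.scalar (Fin 1) (N₁ : O)) (hPQ₁ : P₁ * Q₁ = Matrix.scalar (Fin m₁) (N₁ : O) * E₁)
    (hN₂ : N₂ ≠ 0) (hP₂ : E₂ * P₂ = P₂) (hQ₂ : Q₂ * E₂ = Q₂)
    (hQP₂ : Q₂ * P₂ = Matrix.scalar (Fin 1) (N₂ : O)) (hPQ₂ : P₂ * Q₂ = Matrix.scalar (Fin m₂) (N₂ : O) * E₂)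
    {𝔭 𝔠 : Ideal O} (h𝔭 : Ideal.span (Set.range fun k => P₁ k 0) = 𝔭) (h𝔠 : Ideal.span (Set.range fun k => P₂ k 0) = 𝔠)
    {π₀ π₁ : O} {N : ℕ} (hN : N ≠ 0) (hπ : π₀ * π₁ = (N : O)) (h𝔭𝔠 : 𝔭 * 𝔠 = Ideal.span {π₀})
    (hker : ∀ ⦃T : Over (Spec (.of k))⦄ (t : T ⟶ (AbelianScheme.ofAbelianVariety A).toOver.X),
      t ≫ relFrobeniusHom p n A = 1 ↔ ∀ c ∈ 𝔠, t ≫ act.i c ≫ ρ' = 1) :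
    ∃ E : (AbelianScheme.ofAbelianVariety (A.frobeniusTwist p n)).toOver.X ≅ (AbelianScheme.ofAbelianVariety B).toOver.X,
      IsMonHom E.hom ∧ (∀ a, (act.frobeniusTwist p n).i a ≫ E.hom = E.hom ≫ actB.i a) ∧
        relFrobeniusHom p n A ≫ E.hom ≫ serreTranslate actB E₁ hE₁ P₁ = ρ' ≫ (serreAction actB E₁ hE₁).i π₀ := by
  obtain ⟨e, he, hemon, heeq, -⟩ := exists_iso_relFrobeniusHom_comp_eq_comp_serreTranslate p n act
    (serreAction actB E₁ hE₁) ρ' E₂ hE₂ P₂ Q₂ hρ' hN₂ hP₂ hQ₂ hQP₂ hPQ₂ h𝔠 hker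
  obtain ⟨e', he', he'mon, he'eq, -⟩ := exists_iso_serreTranslate_comp_serreTranslate_comp_eq_i actB E₁ hE₁ P₁ Q₁ E₂ hE₂ P₂ Q₂
    hN₁ hP₁ hQ₁ hQP₁ hPQ₁ hN₂ hP₂ hQ₂ hQP₂ hPQ₂ h𝔭 h𝔠 hN hπ h𝔭𝔠
  haveI := hemon
  haveI := he'mon
  refine ⟨e ≪≫ e', ?_, fun a => ?_, ?_⟩
  · rw [Iso.trans_hom]; infer_instance
  · rw [Iso.trans_hom, ← Category.assoc, heeq a, Category.assoc, he'eq a, Category.assoc]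
  · have h3 := serreTranslate_comp_comp_serreTranslate_eq_i_of actB E₁ hE₁ P₁ Q₁ E₂ hE₂ P₂ hN₁ hP₁ hQ₁ hQP₁ hPQ₁ e'.hom he'
    rw [Iso.trans_hom, Category.assoc, ← Category.assoc (relFrobeniusHom p n A), he, Category.assoc, h3]

end Assembly

end AbelianSchemeOver

end Literature.AlgebraicGeometry.AbelianSchemes

end
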